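import Mathlib
import HarnessLib
import Summits.HubbardSuperconductivity.HubbardSuperconductivity.Theorems.KLProgrammeC4aPPKernelMidBundle
import Summits.HubbardSuperconductivity.HubbardSuperconductivity.Theorems.KLProgrammeC4aPreCausticLevelLineMiddle

/-!
# Route `KLProgramme` — crux C4a, S3 brick (B4) «(B4)-UMK1», «(U1)-M-LAW»: the PRE-CAUSTIC LEVEL LINE FOR THE TRUE COMPARABLE-LEVELS PIECE — k3c3-p3's 5b-M
# `abs_intervalIntegral_levelLine_middle_le` (p703948) with its FIVE KERNEL ROWS DISCHARGED for `K e := ppMidKernelS β Λ κ lo e ·/C` (one call, kernel inputs only)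

Cell `gate-hubbard-kl`, seat hubbard-kl-k3c3-p1 (g17; row «δμ-flow with klAngularMean constant piece»).  The kernel-free one-call of the M-law's first law level,
as `…NearCausticBoxFamilyP` / `…GenericArcSplitC` did for the far piece: the rows `hK hK1 hK2 hcomp hKopp` (and `0 ≤ C_t`, `4 ≤ q_c`) of 5b-M come from
`ppMidKernelS_rows` (`…C4aPPKernelMidBundle`) with `q_c := 2q′`, `q′ = (2−t₁)/t₁`, `C_t := C_t^M/C`; what remains are the LINE data of the law (weight `w`,
factor `X`, partner line `ē` with its two deviation rows, the band flatness number `A_t`, two integrability rows) and the kernel INPUTS `0 < β`, `0 < Λ`,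
`|χ′| ≤ B₁`, `|χ″| ≤ B₂`, `|χ‴| ≤ B₃`, an admissible profile (`κ ∈ C²`, `κ₀ κ₁ κ₂`, `κ = 1/0` below `t₁/2` / above `t₁` with its derivatives, `0 < t₁ ≤ 2/5`),
`0 < lo ≤ Λ`, and a normalisation `C ≥ C₁, C₂`.  For the band flatness `A_t` the consumer may use `abs_midFlatness_band_const_weight_le` (constant weight,
`lo/D²`-class) or the envelopes `abs_intervalIntegral_band_le_of_envelope` / `abs_intervalIntegral_tail_le_of_envelope` of `…MidBundle`.
* **`abs_intervalIntegral_levelLine_ppMid_le`** — THE ONE-CALL.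
Pure real analysis on the model pp kernel; nothing asserts (C), K3, the window or superconductivity.
References: BGM 2006 §2.4 (2.36) [cite: BenfattoGiulianiMastropietro2006]; FST II CPAM 51 (1998) §3 [cite: FeldmanSalmhoferTrubowitz1998].
-/

noncomputable section

namespace Summit.HubbardSuperconductivity.HubbardSuperconductivity.Theorems.C4a

set_option linter.dupNamespace false -- summit = problem name (single-conjunct summit), D-0017

open Real Filter Set MeasureTheory intervalIntegral
open scoped Topology Interval
open Literature.MathematicalPhysics.QuantumLattice Literature.Analysis.SpecialFunctions

section OneCall

variable {β Λ : ℝ} (hβ : 0 < β) (hΛ : 0 < Λ) {B₁ B₂ B₃ : ℝ} (hB₁ : ∀ x, |deriv salmhoferCutoff x| ≤ B₁) (hB₂ : ∀ x, |deriv (deriv salmhoferCutoff) x| ≤ B₂)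
  (hB₃ : ∀ x, |deriv (deriv (deriv salmhoferCutoff)) x| ≤ B₃)
  {κ κ' κ'' : ℝ → ℝ} (hκ : ∀ t, HasDerivAt κ (κ' t) t) (hκ' : ∀ t, HasDerivAt κ' (κ'' t) t) (hκ''c : Continuous κ'')
  {κ₀ κ₁ κ₂ : ℝ} (hκb : ∀ t ∈ Icc 0 1, |κ t| ≤ κ₀) (hκ'b : ∀ t ∈ Icc 0 1, |κ' t| ≤ κ₁) (hκ''b : ∀ t ∈ Icc 0 1, |κ'' t| ≤ κ₂)
  {t₁ : ℝ} (ht₀ : 0 < t₁) (ht25 : t₁ ≤ 2 / 5)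
  (hκs : ∀ t, t₁ ≤ t → κ t = 0) (hκ's : ∀ t, t₁ ≤ t → κ' t = 0) (hκ''s : ∀ t, t₁ ≤ t → κ'' t = 0)
  (hκ1 : ∀ t, t ≤ t₁ / 2 → κ t = 1) (hκ'1 : ∀ t, t ≤ t₁ / 2 → κ' t = 0) (hκ''1 : ∀ t, t ≤ t₁ / 2 → κ'' t = 0)
  {lo hi C : ℝ} (hlo : 0 < lo) (hloΛ : lo ≤ Λ) (hC : 0 < C)

set_option maxHeartbeats 400000 in
include hβ hΛ hB₁ hB₂ hB₃ hκ hκ' hκ''c hκb hκ'b hκ''b ht₀ ht25 hκs hκ's hκ''s hκ1 hκ'1 hκ''1 hlo hloΛ hC in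
/-- **THE PRE-CAUSTIC LEVEL LINE FOR `K e := M(e,·)/C`** — 5b-M `abs_intervalIntegral_levelLine_middle_le` with its kernel rows discharged by `ppMidKernelS_rows`;
`q_c := 2(2−t₁)/t₁`, `C_t := (8q′(Λ/lo)C₁ + ((1+2κ₀)48q′³+16κ₁q′²)/(β·lo))/C`, normalisation `C ≥ C₁, C₂` (the two hypotheses `hC1`, `hC2`).
[cite: BenfattoGiulianiMastropietro2006, §2.4 (2.36)] [cite: FeldmanSalmhoferTrubowitz1998, §3] -/
theorem abs_intervalIntegral_levelLine_ppMid_le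
    (hC1 : (1 + 2 * κ₀) * (128 * B₂ + 216 * B₁ + 294 + (48 * B₁ + 28) * ((2 - t₁) / t₁)) + 2 * κ₁ * (12 * B₁ + 9) ≤ C)
    (hC2 : (1 + 2 * κ₀) * (512 * B₃ + 1664 * B₂ + 5280 * B₁ + 3424 + (256 * B₂ + 384 * B₁ + 504) * ((2 - t₁) / t₁) ^ 2 + (192 * B₁ + 112) * ((2 - t₁) / t₁)) +
          4 * κ₁ * (128 * B₂ + 216 * B₁ + 294 + (48 * B₁ + 28) * ((2 - t₁) / t₁)) +
          (12 * B₁ + 9) * (2 * κ₂ + 2 * κ₁ * ((2 - t₁) / t₁ + 2)) ≤ C)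
    {w X eb : ℝ → ℝ} {D X₀ X₁ W At c₁ Kd : ℝ} (hlohi : lo ≤ hi) (hD : 0 < D) (hX₁ : 0 ≤ X₁) (hc₁ : 0 ≤ c₁) (hKd : 0 ≤ Kd) (hAt : 0 ≤ At)
    (hflatB : |∫ e in (max lo (D / (2 * ((2 - t₁) / t₁) + 3 / 2)))..(min hi (4 * D)), w e * deriv (fun v : ℝ => ppMidKernelS β Λ κ lo e v / C) (D - e)| ≤ At)
    (hfi : IntervalIntegrable (fun e => w e * X e * deriv (fun v : ℝ => ppMidKernelS β Λ κ lo e v / C) (eb e)) volume lo hi)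
    (hgi : IntervalIntegrable (fun e => w e * deriv (fun v : ℝ => ppMidKernelS β Λ κ lo e v / C) (D - e)) volume lo hi)
    (hw0 : ∀ e ∈ Icc lo hi, 0 ≤ w e) (hwW : ∀ e ∈ Icc lo hi, w e ≤ W)
    (hX0 : ∀ e ∈ Icc lo hi, |X e| ≤ X₀) (hXL : ∀ e ∈ Icc lo hi, |X e - X lo| ≤ X₁ * |e - lo|)
    (hdev : ∀ e ∈ Icc lo hi, |eb e - (D - e)| ≤ e / 2) (hdev2 : ∀ e ∈ Icc lo hi, |eb e - (D - e)| ≤ c₁ * e + Kd * e ^ 2) :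
    |∫ e in lo..hi, w e * X e * deriv (fun v : ℝ => ppMidKernelS β Λ κ lo e v / C) (eb e)| ≤
      X₀ * At + W * (16 * (2 * ((2 - t₁) / t₁) + 3 / 2) ^ 3 * X₀ * (c₁ / D) + 64 * (2 * ((2 - t₁) / t₁) + 3 / 2) ^ 3 * X₀ * Kd +
          16 * (2 * ((2 - t₁) / t₁) + 3 / 2) ^ 2 * X₁) +
        W * X₀ * ((8 * ((2 - t₁) / t₁) * (Λ / lo) * ((1 + 2 * κ₀) * (128 * B₂ + 216 * B₁ + 294 + (48 * B₁ + 28) * ((2 - t₁) / t₁)) + 2 * κ₁ * (12 * B₁ + 9)) +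
          ((1 + 2 * κ₀) * (48 * ((2 - t₁) / t₁) ^ 3) + 16 * κ₁ * ((2 - t₁) / t₁) ^ 2) / (β * lo)) / C) * (lo / (max D lo) ^ 2) := by
  have hB0 := salmhoferB₁_nonneg hB₁
  have hB20 : 0 ≤ B₂ := (abs_nonneg _).trans (hB₂ 0)
  have hκ₀ : 0 ≤ κ₀ := (abs_nonneg _).trans (hκb 0 (left_mem_Icc.2 zero_le_one))
  have hκ₁ : 0 ≤ κ₁ := (abs_nonneg _).trans (hκ'b 0 (left_mem_Icc.2 zero_le_one))
  have hq4 : 4 ≤ (2 - t₁) / t₁ := midRatio_ge_four ht₀ ht25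
  obtain ⟨hK, -, hK1, hK2, hcomp, hKopp, -⟩ :=
    ppMidKernelS_rows hβ hΛ hB₁ hB₂ hB₃ hκ hκ' hκ''c hκb hκ'b hκ''b ht₀ ht25 hκs hκ's hκ''s hκ1 hκ'1 hκ''1 hlo hloΛ hC (hi := hi) hC1 hC2
  have hCt : 0 ≤ (8 * ((2 - t₁) / t₁) * (Λ / lo) * ((1 + 2 * κ₀) * (128 * B₂ + 216 * B₁ + 294 + (48 * B₁ + 28) * ((2 - t₁) / t₁)) + 2 * κ₁ * (12 * B₁ + 9)) +
      ((1 + 2 * κ₀) * (48 * ((2 - t₁) / t₁) ^ 3) + 16 * κ₁ * ((2 - t₁) / t₁) ^ 2) / (β * lo)) / C := by positivity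
  exact abs_intervalIntegral_levelLine_middle_le hlo hlohi hD (by linarith) hX₁ hc₁ hKd hCt hAt hK
    (fun e he u => hK1 e (hlo.trans_le he.1) u) (fun e he u => hK2 e (hlo.trans_le he.1) u) hcomp hKopp hflatB hfi hgi hw0 hwW hX0 hXL hdev hdev2

end OneCall

end Summit.HubbardSuperconductivity.HubbardSuperconductivity.Theorems.C4a

end
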